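import Summits.ResolutionOfSingularities.ResolutionOfSingularities.Theorems.FrobeniusLadderFRationalResolutionRetract
import Summits.ResolutionOfSingularities.ResolutionOfSingularities.Theorems.FrobeniusLadderFRationalResolutionRegularDomain
import HarnessLib

/-!
# Direct summands of regular domains have every ideal tightly closed (Hochster–Huneke 1990, Prop. 4.12; ring-map form)

Support file for crux stmt-ResolutionOfSingularities-15317 (`FrobeniusLadder.FRationalResolution`),
line `redirect`, lead c4 (toric surface programme: the stalks of the toric surface
`Spec k[σ∨ ∩ ℤ²]` are direct summands of localizations of `k[ℕ²]`, hence lie in the class of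
rung 4′ — domains with every ideal tightly closed). This file is the generic algebra step,
packaging `weaklyFRegularClause_of_retract` and `weaklyFRegularClause_of_isRegularRing` for a
split ring EMBEDDING given as a ring hom `Λ : R →+* S` with an additive retraction `ρ : S →+ R`
that is `R`-linear through `Λ` (`ρ (Λ t * g) = t * ρ g`) and splits it (`ρ (Λ t) = t`).

If `S` is a regular domain of prime characteristic `p`, then `R` is a domain (it embeds into
`S`) and every ideal `I` of `R` satisfies the inline tight-closure clause
`c ≠ 0 → (∀ e, c * y ^ p ^ e ∈ span {z ^ p ^ e | z ∈ I}) → y ∈ I`.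
Proof: make `S` an `R`-algebra through `Λ` (`RingHom.toAlgebra`), upgrade `ρ` to an `R`-linear
map using `Algebra.smul_def`, and combine the two tree lemmas. Folklore packaging; no published
fact beyond those already cited in the imported files is used.
-/

-- single-problem summit: the doubled namespace component is forced
set_option linter.dupNamespace false

noncomputable section

namespace Summit.ResolutionOfSingularities.ResolutionOfSingularities.Theorems.FRationalResolution

/-- **Direct summands of regular domains of characteristic `p` are domains with every ideal
tightly closed** (ring-map form of Hochster–Huneke 1990, Prop. 4.12 combined with Thm. 4.4).
Given an injective ring hom `Λ : R →+* S` into a regular domain `S` of prime characteristic `p`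
and an additive retraction `ρ : S →+ R` with `ρ (Λ t) = t` and `ρ (Λ t * g) = t * ρ g`, the ring
`R` is a domain and for every ideal `I` of `R` and all `y c : R` with `c ≠ 0`,
`(∀ e, c * y ^ p ^ e ∈ span {z ^ p ^ e | z ∈ I}) → y ∈ I`. -/
theorem stub_clause_of_retract_regular (p : ℕ) [Fact p.Prime] {R S : Type} [CommRing R]
    [CommRing S] [IsDomain S] [CharP S p] [IsRegularRing S] (Λ : R →+* S) (ρ : S →+ R)
    (hΛ : Function.Injective Λ) (h1 : ∀ t, ρ (Λ t) = t) (h2 : ∀ t g, ρ (Λ t * g) = t * ρ g) :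
    IsDomain R ∧ ∀ I : Ideal R, ∀ y c : R, c ≠ 0 →
      (∀ e : ℕ, c * y ^ p ^ e ∈ Ideal.span ((fun z : R => z ^ p ^ e) '' (I : Set R))) →
      y ∈ I := by
  refine ⟨hΛ.isDomain Λ, ?_⟩
  letI : Algebra R S := Λ.toAlgebra
  have hmap : algebraMap R S = Λ := rfl
  let ρₗ : S →ₗ[R] R :=
    { toFun := ρ
      map_add' := ρ.map_add
      map_smul' := fun t g => by
        rw [Algebra.smul_def, hmap, h2, RingHom.id_apply, smul_eq_mul] }
  have hinj : Function.Injective (algebraMap R S) := hmap ▸ hΛ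
  exact weaklyFRegularClause_of_retract p hinj ρₗ (fun r => h1 r)
    (weaklyFRegularClause_of_isRegularRing p S)

end Summit.ResolutionOfSingularities.ResolutionOfSingularities.Theorems.FRationalResolution

end
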